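import Literature.MathematicalPhysics.QuantumFieldTheory.Balaban1983to89.Node00.BgAveragingPrOfRecord
import Literature.MathematicalPhysics.QuantumFieldTheory.Balaban1983to89.B6SectAOntoV1
import Summits.QuantumFields.YangMills.Theorems.BalabanUVNodesN12FlatLinFamilyRightInverseUniform
import Summits.QuantumFields.YangMills.Theorems.BalabanUVNodesN07QOfRecordFlatOnto
import HarnessLib

/-!
# N07 — №608 (2) CONTENT ROW «`Q^{pr}` ONTO», GENERIC HALF: def-Y's framed averaging `QprOfRecord F N k U₀ 𝔥` (✓p829103 `Node00/BgAveragingPrOfRecord`, (A2)) IS ONTO as soon as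
# `qPrCplxOp k U₀ 𝔥` is; in particular WHENEVER `qPrCplxOp k U₀ 𝔥 = c•Q^{str}_k` (`c ≠ 0`, `Q^{str}_k = LatticeFieldCalculus.bondAvgIter k` the straight `k`-fold average) — the shape of
# (A1)'s validation target (V1) at the record's hierarchical frame, `U₀ = 1` — by a matrix-valued right inverse of `Q^{str}_k` (lit ✓`B6SectAOntoV1.bondAvgIter_liftIter`, entrywise)

Cell `pub-ymgap`, width seat `pub-ymgap-dag-n07-w3` (g28), INTENT-5 ∕ CLAIM-5.  `--kind proof --supports stmt-QuantumFields-27238 --as helper`; count-neutral.  The row was ASSIGNED to this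
seat by dag-lead WORDS 814∕815 (★★★ director-ym №608 (2): «surjectivity ∕ small-field onto for `Q^{pr}` = `q^{ff}` onto + finite-rank frame correction»).  [B9] =
[Balaban1985BackgroundPropagators]; [15] = [Balaban1985Variational]; [B5] = [Balaban1984PropagatorsI].

WHAT (kernel, sorry-free, standard axioms).
* §1 (generic torus `P`, any square index type `n`) ★★ `exists_rightInverse_bondAvgIter_matrix` ∕ `bondAvgIter_surjective_matrix` (`k ≤ m + K`): the straight `k`-fold average
  `Q^{str}_k = bondAvgIter k` is ONTO on `M_n(ℂ)`-valued bond fields — lit's real right inverse `liftIter k` (✓`bondAvgIter_liftIter`) applied to the real and imaginary parts of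
  every entry (✓`re_bondAvgIter_entry` ∕ ✓`im_bondAvgIter_entry`, dag-n10-w1's N12 letters).
* §2 (the record) ★★ `QprOfRecord_surjective_of_qPrCplxOp`: `Function.Surjective (qPrCplxOp k U₀ 𝔥) → Function.Surjective (QprOfRecord F N k U₀ 𝔥)` (the read-in∕read-out are onto,
  ✓`bondFieldIn_surjective` ∕ ✓`bondFieldOut_surjective`); ★★★ `QprOfRecord_surjective_of_eq_smul_bondAvgIter`: if `∀ X, qPrCplxOp k U₀ 𝔥 X = c • bondAvgIter k X` with `c ≠ 0`
  (the (V1)-shape: «at the record's frame, `Q^{pr} = q^{ff} − ∂∘Dh = Q^{str}`», dag-n06-l's `Q^{ff} = Q^{str} + d_c∘G_k`) then `QprOfRecord F N k U₀ 𝔥` is ONTO — the `hQ` binder of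
  def-Y's (A3) `frakGprOfRecordAtBg ∕ H1prOfRecordAtBg … hpos hQ` DISCHARGED for every such datum; `…_of_eq_bondAvgIter` (`c = 1`).
* §4 (v1.1, APPEND) ★★★ `QprOfRecord_one_surjective_of_intertwines` — THE RECORD HALF MODULO (V2) ONLY: at `U₀ = 1`, for EVERY datum `𝔥` with def-Y's displayed token
  `FrameIntertwinesTok F N k 1 𝔥` ((3.114); (A1)'s validation target (V2)), `QprOfRecord F N k 1 𝔥` is ONTO (`k ≤ m + K`) — «`q^{ff}` onto (✓`qCplxOp_one_surjective`) + finite-rank frame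
  correction via the coarse-constant lift» (`siteAvgStep_one_comp_blockOf`, `siteAvgIter_one_surjective`: the `k`-step block mean `Q′_k(1)` of record is onto); no (V1)∕`Q^{str}` identity needed.
* §3 VACUITY GUARD ★ `QprOfRecord_frameless_one_surjective`: over the frameless datum `Q^{pr} = QOfRecord` (✓`QprOfRecord_frameless`), onto at `U₀ = 1` by this lineage's
  ✓`QOfRecord_one_surjective` — the framed row says nothing new there, as designed.

HONEST LABELS.  Linear algebra over landed letters; for a GENERIC datum `𝔥` surjectivity of `q^{ff} − ∂∘Dh∘(·U₀)` is NOT automatic (a surjection minus a finite-rank map need not be onto) and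
stays the displayed `hQ`; the content enters through (V1) for the record's inhabitant (def-Y (A1) `BgHierFrameOfRecord`, not yet in the tree at the time of typing — this file displays the
(V1)-shape as a hypothesis and discharges everything downstream of it).  Nothing of Bałaban's estimates; K0ᴬ ⟨27238⟩ NOT closed; N07 NOT discharged; R4 is the conditional finite-𝕋⁴ rung
`BalabanLadder.UV` only; finite torus, fixed `ε` — nothing continuum ∕ OS ∕ Clay.  **The Yang–Mills mass gap is NOT proved by any of this.**  No `sorry`, no `def`, no `instance ∕ notation`.
-/

set_option autoImplicit false

noncomputable section

open scoped BigOperators Matrix.Norms.L2Operator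

namespace Summit.QuantumFields.YangMills.Theorems.N07QprOfRecordOnto

open Literature.MathematicalPhysics.QuantumFieldTheory.Balaban1983to89
open Literature.MathematicalPhysics.QuantumFieldTheory.Balaban1983to89.T4Continuum (T4Family)
open Literature.MathematicalPhysics.QuantumFieldTheory.Balaban1983to89.Node00
open LatticeFieldCalculus (bondAvgIter)
open B6SectAOntoV1 (liftIter bondAvgIter_liftIter)
open Summit.QuantumFields.YangMills.BalabanUVNodes.N12FlatLinFamilyRightInverseUniform (re_bondAvgIter_entry im_bondAvgIter_entry)
open Summit.QuantumFields.YangMills.Theorems.N07QOfRecordFlatOnto (bondFieldIn_surjective bondFieldOut_surjective QOfRecord_one_surjective)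

/-! ## §1  The straight `k`-fold average is onto on matrix-valued bond fields -/

section Lattice

variable {P : Params} {n : Type*}

/-- ★★ **A MATRIX-VALUED RIGHT INVERSE OF `Q^{str}_k = bondAvgIter k`** (`k ≤ m + K`): lit's real lift `liftIter k` (✓`bondAvgIter_liftIter`: `Q_k(liftIter_k B) = B` on `ℝ`-valued fields)
applied to the real and imaginary part of every matrix entry. [cite: Balaban1984PropagatorsI, (1.18) p.20; Balaban1985BackgroundPropagators, (3.13)–(3.15) p.393] -/
theorem exists_rightInverse_bondAvgIter_matrix {k : ℕ} (hk : k ≤ P.m + P.K) :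
    ∃ R : (PBond P k → Matrix n n ℂ) → (PBond P 0 → Matrix n n ℂ), ∀ Z : PBond P k → Matrix n n ℂ, bondAvgIter k (R Z) = Z := by
  refine ⟨fun Z b => Matrix.of fun i j =>
      ((liftIter k (fun c => (Z c i j).re) b : ℝ) : ℂ) + ((liftIter k (fun c => (Z c i j).im) b : ℝ) : ℂ) * Complex.I, fun Z => ?_⟩
  funext c
  ext i j
  apply Complex.ext
  · rw [re_bondAvgIter_entry]
    have h : (fun b : PBond P 0 => ((Matrix.of fun i j =>
        ((liftIter k (fun c => (Z c i j).re) b : ℝ) : ℂ) + ((liftIter k (fun c => (Z c i j).im) b : ℝ) : ℂ) * Complex.I) i j).re) =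
        liftIter k (fun c => (Z c i j).re) := by
      funext b; simp [Matrix.of_apply]
    rw [h, bondAvgIter_liftIter k hk]
  · rw [im_bondAvgIter_entry]
    have h : (fun b : PBond P 0 => ((Matrix.of fun i j =>
        ((liftIter k (fun c => (Z c i j).re) b : ℝ) : ℂ) + ((liftIter k (fun c => (Z c i j).im) b : ℝ) : ℂ) * Complex.I) i j).im) =
        liftIter k (fun c => (Z c i j).im) := by
      funext b; simp [Matrix.of_apply]
    rw [h, bondAvgIter_liftIter k hk]

/-- ★★ **`Q^{str}_k` IS ONTO ON `M_n(ℂ)`-VALUED BOND FIELDS** (`k ≤ m + K`). [cite: Balaban1984PropagatorsI, (1.18) p.20; Balaban1985Variational, (45) p.285] -/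
theorem bondAvgIter_surjective_matrix {k : ℕ} (hk : k ≤ P.m + P.K) :
    Function.Surjective (fun X : PBond P 0 → Matrix n n ℂ => bondAvgIter k X) := by
  obtain ⟨R, hR⟩ := exists_rightInverse_bondAvgIter_matrix (P := P) (n := n) hk
  exact fun Z => ⟨R Z, hR Z⟩

end Lattice

/-! ## §2  At the record: `QprOfRecord` onto from `qPrCplxOp` onto; the (V1)-shape criterion -/

section Record

variable (F : T4Family) (N : ℕ) (K k : ℕ) (U₀ : GaugeField (F.P K) 0 (SU N))

/-- ★★ **`QprOfRecord F N k U₀ 𝔥` IS ONTO AS SOON AS `qPrCplxOp k U₀ 𝔥` IS** (`QprOfRecord = bondFieldOut ∘ qPrCplxOp ∘ bondFieldIn`, the outer two onto).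
[cite: Balaban1985BackgroundPropagators, (3.13)–(3.16) p.393, (3.113) p.418; Balaban1985Variational, (45) p.285] -/
theorem QprOfRecord_surjective_of_qPrCplxOp (𝔥 : FrameDatum (F.P K) N k U₀) (h : Function.Surjective (qPrCplxOp k U₀ 𝔥)) :
    Function.Surjective (QprOfRecord F N k U₀ 𝔥) := by
  show Function.Surjective (bondFieldOut F N k ∘ₗ qPrCplxOp k U₀ 𝔥 ∘ₗ bondFieldIn F N k)
  rw [LinearMap.coe_comp, LinearMap.coe_comp]
  exact (bondFieldOut_surjective F N K k).comp (h.comp (bondFieldIn_surjective F N K k))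

/-- ★★★ **THE (V1)-SHAPE CRITERION**: if at the datum `𝔥` the framed linearised averaging IS a nonzero multiple of the straight `k`-fold average, `qPrCplxOp k U₀ 𝔥 X = c • Q^{str}_k X`
(«`Q^{pr} = q^{ff} − ∂∘Dh = Q^{str}`» at the record's hierarchical frame, def-Y (A1)'s validation target (V1)), then `QprOfRecord F N k U₀ 𝔥` is ONTO (`k ≤ m + K`) — the `hQ` binder of the
framed `𝔊^{pr}`∕`H₁^{pr}` letters DISCHARGED for such data. [cite: Balaban1985Variational, (45) p.285, (103) p.293; Balaban1985BackgroundPropagators, (3.13)–(3.15) p.393, (3.113)–(3.115) p.418; Balaban1984PropagatorsI, (1.18) p.20] -/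
theorem QprOfRecord_surjective_of_eq_smul_bondAvgIter (𝔥 : FrameDatum (F.P K) N k U₀) (hk : k ≤ (F.P K).m + (F.P K).K) {c : ℂ} (hc : c ≠ 0)
    (hV1 : ∀ X : PBond (F.P K) 0 → Matrix (Fin N) (Fin N) ℂ, qPrCplxOp k U₀ 𝔥 X = c • bondAvgIter k X) :
    Function.Surjective (QprOfRecord F N k U₀ 𝔥) := by
  refine QprOfRecord_surjective_of_qPrCplxOp F N K k U₀ 𝔥 fun Z => ?_
  obtain ⟨X, hX⟩ := bondAvgIter_surjective_matrix (P := F.P K) (n := Fin N) hk (c⁻¹ • Z)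
  refine ⟨X, ?_⟩
  have hX' : bondAvgIter k X = c⁻¹ • Z := hX
  rw [hV1, hX', smul_smul, mul_inv_cancel₀ hc, one_smul]

/-- The same with `c = 1`: `qPrCplxOp k U₀ 𝔥 = Q^{str}_k` ⟹ `QprOfRecord … 𝔥` onto. [cite: Balaban1985Variational, (45) p.285; Balaban1984PropagatorsI, (1.18) p.20] -/
theorem QprOfRecord_surjective_of_eq_bondAvgIter (𝔥 : FrameDatum (F.P K) N k U₀) (hk : k ≤ (F.P K).m + (F.P K).K)
    (hV1 : ∀ X : PBond (F.P K) 0 → Matrix (Fin N) (Fin N) ℂ, qPrCplxOp k U₀ 𝔥 X = bondAvgIter k X) :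
    Function.Surjective (QprOfRecord F N k U₀ 𝔥) :=
  QprOfRecord_surjective_of_eq_smul_bondAvgIter F N K k U₀ 𝔥 hk one_ne_zero fun X => by rw [hV1, one_smul]

/-! ## §3  Vacuity guard: the frameless datum -/

/-- ★ **OVER THE FRAMELESS DATUM NOTHING NEW**: `QprOfRecord F N k 1 (frameless) = QOfRecord F N k 1` (✓`QprOfRecord_frameless`), onto for `k ≤ m + K` by this lineage's
✓`QOfRecord_one_surjective`. [cite: Balaban1985BackgroundPropagators, (3.13) p.393; Balaban1985Variational, (45) p.285] -/
theorem QprOfRecord_frameless_one_surjective [NeZero N] (hk : k ≤ F.m + K) :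
    Function.Surjective (QprOfRecord F N k (1 : GaugeField (F.P K) 0 (SU N)) (FrameDatum.frameless k (1 : GaugeField (F.P K) 0 (SU N)))) := by
  rw [QprOfRecord_frameless]
  exact QOfRecord_one_surjective F N K k hk

end Record

/-! ## §4 (v1.1)  THE RECORD HALF MODULO (V2) ONLY: at `U₀ = 1`, `Q^{pr}` IS ONTO FOR EVERY FRAME DATUM THAT INTERTWINES ((3.114)) — «`q^{ff}` onto + finite-rank frame
correction via the coarse-constant lift» (def-Y's PRICE-2 (P3) road, typed): no (V1)∕`Q^{str}` identity needed -/

section CoarseLift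

open Summit.QuantumFields.YangMills.Theorems.N07QOfRecordFlatOnto (qCplxOp_one_surjective)

variable {P : Params} {N : ℕ}

/-- **Block means of block-pull-backs at the flat background**: `Q′(1)(μ ∘ blockOf) = μ` (one step; the centre transporters are `1`, the `L^d` block sites each contribute `L^{-d}μ(y)`).
[cite: Balaban1985BackgroundPropagators, (3.18)–(3.19) p.393; Balaban1985Averaging, (42) p.23] -/
theorem siteAvgStep_one_comp_blockOf [NeZero N] {j : ℕ} (hj : j + 1 ≤ P.m + P.K) (μ : Site P (j + 1) → Matrix (Fin N) (Fin N) ℂ) :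
    siteAvgStep (1 : GaugeField P j (SU N)) (fun x => μ (blockOf x)) = μ := by
  funext y
  rw [siteAvgStep_apply]
  have hhol : ∀ r : Fin P.d → Fin P.L, ((ctrHol (1 : GaugeField P j (SU N)) y r : SU N) : Matrix (Fin N) (Fin N) ℂ) = 1 := fun r => by
    unfold ctrHol
    rw [T3DescentFibreTower.holAt_one]
    rfl
  simp_rw [hhol, one_mul, star_one, mul_one, Site.blockOf_blockSite hj, Finset.sum_const, Finset.card_univ, Fintype.card_fun, Fintype.card_fin]
  rw [← Nat.cast_smul_eq_nsmul ℂ, smul_smul, Nat.cast_pow, mul_inv_cancel₀ (pow_ne_zero _ (Nat.cast_ne_zero.mpr P.L_pos.ne')), one_smul]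

variable (F : T4Family) (N : ℕ) [NeZero N] (K : ℕ)

/-- ★ **THE `k`-STEP BLOCK MEAN OF RECORD AT THE FLAT BACKGROUND IS ONTO** (`k ≤ m + K`): every coarse site field is `Q′_k(1)` of a fine one (induction: pull back along `blockOf`;
`Ū^j(1) = 1` at every intermediate level, lit ✓`iter_avOfRecord_one`). [cite: Balaban1985BackgroundPropagators, (3.19) p.393; Balaban1985Averaging, (43) p.24] -/
theorem siteAvgIter_one_surjective : ∀ (k : ℕ), k ≤ (F.P K).m + (F.P K).K →
    Function.Surjective (siteAvgIter (avOfRecord F N K) (1 : GaugeField (F.P K) 0 (SU N)) k)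
  | 0, _ => fun μ => ⟨μ, rfl⟩
  | k + 1, hk => fun μ => by
      obtain ⟨lam, hlam⟩ := siteAvgIter_one_surjective k (Nat.le_of_succ_le hk) (fun x => μ (blockOf x))
      refine ⟨lam, ?_⟩
      rw [siteAvgIter_succ, LinearMap.comp_apply, hlam, B15Claim189UnitTestAtRecord.iter_avOfRecord_one (F := F) (N := N) K k, siteAvgStep_one_comp_blockOf hk]

/-- ★★★ **THE RECORD HALF OF THE ONTO ROW, MODULO (V2) ONLY**: at `U₀ = 1`, for EVERY frame datum `𝔥` that intertwines the gauge directions with print's block mean (def-Y's displayed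
token `FrameIntertwinesTok` — (3.114), (A1)'s validation target (V2) for the record's inhabitant), `QprOfRecord F N k 1 𝔥` is ONTO (`k ≤ m + K`).  Proof = «`q^{ff}` onto + finite-rank frame
correction via the coarse-constant lift»: given `Z`, take `q^{ff}A = Z` (✓`qCplxOp_one_surjective`); the defect `Q^{pr}A − Z = −L^{-k}∂_k(Dh(A·1))` is a coarse gradient; lift `μ := Dh(A·1)` to a
fine site field `λ` with `Q′_k(1)λ = μ` (`siteAvgIter_one_surjective`) and add the pure-gauge field `Dλ`: by (V2) `Q^{pr}(Dλ) = L^{-k}∂_k(Q′λ) = L^{-k}∂_kμ`, so `Q^{pr}(A + Dλ) = Z`.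
[cite: Balaban1985BackgroundPropagators, (3.113)–(3.115) p.418, (3.13)–(3.15) p.393; Balaban1985Variational, (45) p.285, (103) p.293] -/
theorem QprOfRecord_one_surjective_of_intertwines {k : ℕ} (𝔥 : FrameDatum (F.P K) N k (1 : GaugeField (F.P K) 0 (SU N)))
    (hk : k ≤ (F.P K).m + (F.P K).K) (hV2 : FrameIntertwinesTok F N k (1 : GaugeField (F.P K) 0 (SU N)) 𝔥) :
    Function.Surjective (QprOfRecord F N k (1 : GaugeField (F.P K) 0 (SU N)) 𝔥) := by
  refine QprOfRecord_surjective_of_qPrCplxOp F N K k (1 : GaugeField (F.P K) 0 (SU N)) 𝔥 fun Z => ?_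
  obtain ⟨A, hA⟩ := qCplxOp_one_surjective (P := F.P K) (N := N) hk Z
  obtain ⟨lam, hlam⟩ := siteAvgIter_one_surjective F N K k hk (𝔥.deriv (leftVelC (1 : GaugeField (F.P K) 0 (SU N)) A))
  refine ⟨A + fun b : PBond (F.P K) 0 => ((1 : GaugeField (F.P K) 0 (SU N)) b : Matrix (Fin N) (Fin N) ℂ) * lam b.tgt *
      star (((1 : GaugeField (F.P K) 0 (SU N)) b : Matrix (Fin N) (Fin N) ℂ)) - lam b.src, ?_⟩
  funext c
  rw [map_add, Pi.add_apply, hV2 lam c, hlam, qPrCplxOp_apply, Pi.sub_apply, hA, frameCorr_apply, B15Claim189UnitTestAtRecord.iter_avOfRecord_one (F := F) (N := N) K k, coeField_one, iterM_apply_one]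
  have h1 : ((1 : GaugeField (F.P K) k (SU N)) c : Matrix (Fin N) (Fin N) ℂ) = 1 := rfl
  simp only [h1, Pi.one_apply, one_mul, star_one, mul_one, sub_add_cancel]

end CoarseLift

end Summit.QuantumFields.YangMills.Theorems.N07QprOfRecordOnto

end
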